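import Summits.CriticalPhenomena.PercolationContinuityZ3.Theorems.PercNearOneGluingNoHeavyLowerTailStarSetClassData
import Summits.CriticalPhenomena.PercolationContinuityZ3.Theorems.PercNearOneGluingNoHeavyLowerTailStarSetClassWordsBudget
import Summits.CriticalPhenomena.PercolationContinuityZ3.Theorems.PercNearOneGluingNoHeavyLowerTailStarSetConfigExpansion
import Summits.CriticalPhenomena.PercolationContinuityZ3.Theorems.PercNearOneGluingNoHeavyLowerTailStarSetNestedCertificateCore
import Summits.CriticalPhenomena.PercolationContinuityZ3.Theorems.PercNearOneGluingNoHeavyLowerTailStarSetRegroup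
import HarnessLib

/-!
# `NoHeavyLowerTail` (stmt-CriticalPhenomena-4575) — U1′_r from the class-level charging theorem (blueprint B7c: the star-level glue)

Support file (prover `prim-gen-swap` gen 13; `--supports stmt-CriticalPhenomena-4575`).  No definitions, no named facts, no sorries.

`StarSet.mwf_supply_U1_of_classLevel`: the r-avoiding MWF supply inequality U1′_r — hypothesis `hU1` of
`StarSet.setCS_twoPortStarMultigraph_mixed_levelTwo_of_U1` (p209479), in the exact form of the gen-9 TARGET with `hmaxweight` replaced by the
local domination hypothesis `hdomF` of `mwf_supply_U0` — FOLLOWS from the class-level charging theorem of LEAN-BLUEPRINT-U1.md §B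
(`StarSet.charging_classLevel`, statement = ChargingTargets.TARGET.lean, taken here as the hypothesis `hclass` at the types `Fin (Mf+Mc)`, `Fin n`).
Proof: if `C0 = Π a_i(0) = 0` both sides are trivial; otherwise all `θ_i < 1`, the class data (`classData_hypotheses`, dominators chosen from
`hdomF`) satisfy the hypotheses of `hclass`, `config_expansion_identity` identifies the left side with `C0·(1 + Σ_S W(S)(n(S) − y(S)))`, and the class-word
masses (`classWord_mass_eq`) are bounded by the budget `κ₃(r)` (`classWords_budget_le`).  Once `charging_classLevel` is in the tree,
`mwf_supply_U1 := mwf_supply_U1_of_classLevel charging_classLevel …` and OES_{j≤2} holds for every two-port star multigraph.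
-/

noncomputable section

namespace Summit.CriticalPhenomena.PercolationContinuityZ3.Theorems

open Finset
open scoped Classical BigOperators

namespace StarSet

variable {n m Mf Mc : ℕ}

/-- **U1′_r from the class-level charging theorem.**  See the file header. -/
theorem mwf_supply_U1_of_classLevel
    (hclass : ∀ (P P' : Fin (Mf + Mc) → Fin n) (_ : ∀ X, P X ≠ P' X)
      (_ : Function.Injective fun X => (s(P X, P' X) : Sym2 (Fin n))) (r : Fin n) (F : Finset (Fin (Mf + Mc)))
      (_ : ∀ K ∈ F, ∀ I ∈ F, K < I → P' K ≠ P I ∧ P' K ≠ P' I)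
      (θ : Fin (Mf + Mc) → ℝ) (_ : ∀ X, 0 ≤ θ X) (_ : ∀ X, θ X < 1)
      (O : Fin (Mf + Mc) → Fin n → ℝ) (_ : ∀ X d, 0 ≤ O X d) (Φ : Fin (Mf + Mc) → ℝ)
      (_ : ∀ X d, (P X = d ∨ P' X = d) → θ X ≤ (1 - θ X) * O X d)
      (_ : ∀ X, Φ X ^ 2 ≤ O X (P X) * O X (P' X))
      (_ : ∀ X, 4 * θ X ≤ Φ X) (_ : ∀ X, θ X ≤ Φ X ^ 2)
      (dom : Fin (Mf + Mc) → Fin n → Fin (Mf + Mc))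
      (_ : ∀ X ∉ F, ∀ d, (P X = d ∨ P' X = d) →
        dom X d ∈ F ∧ (P (dom X d) = d ∨ P' (dom X d) = d) ∧
          (∀ u, (P (dom X d) = u ∨ P' (dom X d) = u) → (P X = u ∨ P' X = u) → u = d) ∧ θ X ≤ θ (dom X d)),
      ∑ S ∈ (univ : Finset (Fin (Mf + Mc))).powerset, ((∏ k ∈ S, θ k) * ∏ k ∈ univ \ S, (1 - θ k)) *
          ((∑ κ ∈ (univ \ F).filter (fun κ => P κ ≠ r ∧ P' κ ≠ r),
              (if (κ ∈ S ∧ ∀ j ∈ univ.filter (fun j => ¬ (P j = P κ ∨ P j = P' κ ∨ P' j = P κ ∨ P' j = P' κ)), j ∉ S)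
                then (1 : ℝ) else 0)) -
            ((if (∀ I ∈ F, I ∉ S) then (1 : ℝ) else 0) +
              ∑ a ∈ F.filter (fun a => P a = r), (if (a ∈ S ∧ ∀ b ∈ F.filter (· < a), b ∉ S) then (1 : ℝ) else 0))) ≤
        ∑ T ∈ (univ : Finset (Fin (Mf + Mc))).powerset,
          ∑ δ ∈ (univ : Finset (Fin (Mf + Mc) → Bool)).filter (fun δ => (∀ X ∉ T, δ X = false) ∧
              3 ≤ (T.image fun X => if δ X then P X else P' X).card ∧ r ∉ T.image fun X => if δ X then P X else P' X),
            ∏ X ∈ T, O X (if δ X then P X else P' X))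
    (w : Sym2 (Fin n) → unitInterval) (s p p' : Fin m → Fin n)
    (cls : Fin m → Fin (Mf + Mc)) (P P' : Fin (Mf + Mc) → Fin n) (hP : ∀ i, p i = P (cls i)) (hP' : ∀ i, p' i = P' (cls i))
    (hPP' : ∀ κ, P κ ≠ P' κ)
    (hnopar : ∀ I K : Fin (Mf + Mc), I ≠ K → ¬ ((P K = P I ∨ P K = P' I) ∧ (P' K = P I ∨ P' K = P' I)))
    (hforest : ∀ K I : Fin Mf, K < I → P' (Fin.castAdd Mc K) ≠ P (Fin.castAdd Mc I) ∧ P' (Fin.castAdd Mc K) ≠ P' (Fin.castAdd Mc I))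
    (hdomF : ∀ K : Fin Mc, ∀ d : Fin n, (d = P (Fin.natAdd Mf K) ∨ d = P' (Fin.natAdd Mf K)) →
      ∃ I : Fin Mf, (P (Fin.castAdd Mc I) = d ∨ P' (Fin.castAdd Mc I) = d) ∧
        (P (Fin.castAdd Mc I) ∉ ({P (Fin.natAdd Mf K), P' (Fin.natAdd Mf K)} : Finset (Fin n)) ∨
          P' (Fin.castAdd Mc I) ∉ ({P (Fin.natAdd Mf K), P' (Fin.natAdd Mf K)} : Finset (Fin n))) ∧
        ∏ i ∈ Finset.univ.filter (fun i => cls i = Fin.castAdd Mc I), (1 - (w s(s i, p i) : ℝ) * w s(s i, p' i)) ≤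
          ∏ i ∈ Finset.univ.filter (fun i => cls i = Fin.natAdd Mf K), (1 - (w s(s i, p i) : ℝ) * w s(s i, p' i)))
    (r : Fin n) :
    (∏ i, (if (w s(s i, p i) : ℝ) * w s(s i, p' i) < 1 then
          ((1 - (w s(s i, p i) : ℝ)) * (1 - w s(s i, p' i))) / (1 - (w s(s i, p i) : ℝ) * w s(s i, p' i)) else 0)) *
        (∑ I ∈ (Finset.univ : Finset (Fin Mf)).filter (fun I => P (Fin.castAdd Mc I) ≠ r),
            ((1 - ∏ i ∈ Finset.univ.filter (fun i => cls i = Fin.castAdd Mc I), (1 - (w s(s i, p i) : ℝ) * w s(s i, p' i))) *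
          ∏ K ∈ Finset.univ.filter (· < I), ∏ i ∈ Finset.univ.filter (fun i => cls i = Fin.castAdd Mc K), (1 - (w s(s i, p i) : ℝ) * w s(s i, p' i))) +
        ∑ K ∈ (Finset.univ : Finset (Fin Mc)).filter (fun K => P (Fin.natAdd Mf K) ≠ r ∧ P' (Fin.natAdd Mf K) ≠ r),
            ((1 - ∏ i ∈ Finset.univ.filter (fun i => cls i = Fin.natAdd Mf K), (1 - (w s(s i, p i) : ℝ) * w s(s i, p' i))) *
          ∏ κ' ∈ Finset.univ.filter (fun κ' => ¬ (P κ' = P (Fin.natAdd Mf K) ∨ P κ' = P' (Fin.natAdd Mf K) ∨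
              P' κ' = P (Fin.natAdd Mf K) ∨ P' κ' = P' (Fin.natAdd Mf K))),
            ∏ i ∈ Finset.univ.filter (fun i => cls i = κ'), (1 - (w s(s i, p i) : ℝ) * w s(s i, p' i)))) ≤
      (∏ i, (if (w s(s i, p i) : ℝ) * w s(s i, p' i) < 1 then
          ((1 - (w s(s i, p i) : ℝ)) * (1 - w s(s i, p' i))) / (1 - (w s(s i, p i) : ℝ) * w s(s i, p' i)) else 0)) +
      ∑ e ∈ (Finset.univ : Finset (Fin m → Fin 3)).filter (fun e =>
          r ∉ (Finset.univ.filter fun i => e i = 1).image p ∪ (Finset.univ.filter fun i => e i = 2).image p'),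
        (if 3 ≤ ((Finset.univ.filter fun i => e i = 1).image p ∪ (Finset.univ.filter fun i => e i = 2).image p').card then
          ∏ i, (if (w s(s i, p i) : ℝ) * w s(s i, p' i) < 1 then
            ((if e i = 1 then (w s(s i, p i) : ℝ) else 1 - w s(s i, p i)) *
              (if e i = 2 then (w s(s i, p' i) : ℝ) else 1 - w s(s i, p' i))) / (1 - (w s(s i, p i) : ℝ) * w s(s i, p' i))
          else if e i = 1 then 1 else 0) else 0) := by
  -- (0) abbreviations
  set θ : Fin m → ℝ := fun i => (w s(s i, p i) : ℝ) * w s(s i, p' i) with hθ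
  have hθ0 : ∀ i, 0 ≤ θ i := fun i => mul_nonneg (w _).2.1 (w _).2.1
  have hθ1 : ∀ i, θ i ≤ 1 := fun i => mul_le_one₀ (w _).2.2 (w _).2.1 (w _).2.2
  set St : Fin (Mf + Mc) → Finset (Fin m) := fun κ => univ.filter (fun i => cls i = κ) with hSt
  set uu : Fin (Mf + Mc) → ℝ := fun κ => ∏ i ∈ univ.filter (fun i => cls i = κ), (1 - θ i) with huu
  have huu0 : ∀ κ, 0 ≤ uu κ := fun κ => prod_nonneg fun i _ => sub_nonneg.2 (hθ1 i)
  have huu1 : ∀ κ, uu κ ≤ 1 := fun κ => prod_le_one (fun i _ => sub_nonneg.2 (hθ1 i)) fun i _ => sub_le_self _ (hθ0 i)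
  set A : Fin m → Fin 3 → ℝ := fun x k => if θ x < 1 then
      ((if k = 1 then (w s(s x, p x) : ℝ) else 1 - w s(s x, p x)) * (if k = 2 then (w s(s x, p' x) : ℝ) else 1 - w s(s x, p' x))) / (1 - θ x)
    else if k = 1 then 1 else 0 with hA
  have hAnn : ∀ x k, 0 ≤ A x k := fun x k => extremeCoeff_nonneg _ _ (w _).2.1 (w _).2.2 (w _).2.1 (w _).2.2 k
  have hA0 : ∀ x, (if θ x < 1 then ((1 - (w s(s x, p x) : ℝ)) * (1 - w s(s x, p' x))) / (1 - θ x) else 0) = A x 0 := by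
    intro x; simp only [hA]; simp
  have hA1 : ∀ x, A x 1 = (if θ x < 1 then ((w s(s x, p x) : ℝ) * (1 - w s(s x, p' x))) / (1 - θ x) else 1) := by
    intro x; simp only [hA]; simp
  have hA2 : ∀ x, A x 2 = (if θ x < 1 then ((1 - (w s(s x, p x) : ℝ)) * w s(s x, p' x)) / (1 - θ x) else 0) := by
    intro x; simp only [hA]; simp
  set coef : (Fin m → Fin 3) → ℝ := fun e => ∏ x, A x (e x) with hcoef
  set C0 : ℝ := ∏ x, A x 0 with hC0
  have hC0nn : 0 ≤ C0 := prod_nonneg fun x _ => hAnn x 0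
  set Rw : (Fin m → Fin 3) → Finset (Fin n) := fun e =>
    (univ.filter fun i => e i = 1).image p ∪ (univ.filter fun i => e i = 2).image p' with hRw
  have hE0 : (∏ x, (if θ x < 1 then ((1 - (w s(s x, p x) : ℝ)) * (1 - w s(s x, p' x))) / (1 - θ x) else 0)) = C0 :=
    prod_congr rfl fun x _ => hA0 x
  set cfF : Fin Mf → ℝ := fun I => (1 - uu (Fin.castAdd Mc I)) * ∏ K ∈ univ.filter (· < I), uu (Fin.castAdd Mc K) with hcfF
  set D : Fin Mc → ℝ := fun K => (1 - uu (Fin.natAdd Mf K)) *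
    ∏ κ' ∈ univ.filter (fun κ' => ¬ (P κ' = P (Fin.natAdd Mf K) ∨ P κ' = P' (Fin.natAdd Mf K) ∨
      P' κ' = P (Fin.natAdd Mf K) ∨ P' κ' = P' (Fin.natAdd Mf K))), uu κ' with hD
  have hbudget_nn : 0 ≤ ∑ e ∈ (univ : Finset (Fin m → Fin 3)).filter (fun e => r ∉ Rw e),
      (if 3 ≤ (Rw e).card then coef e else 0) :=
    sum_nonneg fun e _ => by
      split_ifs
      · exact prod_nonneg fun x _ => hAnn x _
      · exact le_rfl
  change C0 * (∑ I ∈ univ.filter (fun I => P (Fin.castAdd Mc I) ≠ r), cfF I +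
      ∑ K ∈ univ.filter (fun K => P (Fin.natAdd Mf K) ≠ r ∧ P' (Fin.natAdd Mf K) ≠ r), D K) ≤
    C0 + ∑ e ∈ (univ : Finset (Fin m → Fin 3)).filter (fun e => r ∉ Rw e), (if 3 ≤ (Rw e).card then coef e else 0)
  -- (1) the degenerate case `C0 = 0`
  rcases eq_or_lt_of_le hC0nn with hC00 | hC0pos
  · rw [← hC00, zero_mul, zero_add]; exact hbudget_nn
  -- from now on `C0 > 0`: every `a_i(0) > 0` and every `θ_i < 1`
  have hApos : ∀ x, 0 < A x 0 := by
    intro x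
    rcases eq_or_lt_of_le (hAnn x 0) with h | h
    · exfalso
      have : C0 = 0 := prod_eq_zero (mem_univ x) h.symm
      exact absurd this (ne_of_gt hC0pos)
    · exact h
  have hθlt : ∀ x, θ x < 1 := by
    intro x
    by_contra h
    have : A x 0 = 0 := by rw [← hA0 x, if_neg h]
    exact absurd this (ne_of_gt (hApos x))
  have hA0ne : ∀ x, A x 0 ≠ 0 := fun x => ne_of_gt (hApos x)
  -- one-star bounds in terms of `A`
  have hstar1 : ∀ i, A i 0 ≤ (1 - θ i) * (A i 0 + A i 1) := by
    intro i; rw [← hA0 i, hA1 i]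
    exact coeffZero_le_oneSubTheta_mul_sum _ _ (w _).2.1 (w _).2.2 (w _).2.1 (w _).2.2
  have hstar2 : ∀ i, A i 0 ≤ (1 - θ i) * (A i 0 + A i 2) := by
    intro i; rw [← hA0 i, hA2 i]
    exact coeffZero_le_oneSubTheta_mul_sum' _ _ (w _).2.1 (w _).2.2 (w _).2.1 (w _).2.2
  have hgm : ∀ i, A i 0 ^ 2 * θ i ≤ A i 1 * A i 2 * (1 - Real.sqrt (θ i)) ^ 2 := by
    intro i; rw [← hA0 i, hA1 i, hA2 i]
    exact extremeCoeff_one_mul_two _ _ (w _).2.1 (w _).2.2 (w _).2.1 (w _).2.2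
  -- (2) class-level data
  set F : Finset (Fin (Mf + Mc)) := univ.filter (fun κ => (κ : ℕ) < Mf) with hF
  set Θ : Fin (Mf + Mc) → ℝ := fun κ => 1 - uu κ with hΘ
  set O : Fin (Mf + Mc) → Fin n → ℝ := fun κ d =>
    if d = P κ then (∏ i ∈ St κ, (A i 0 + A i 1)) / (∏ i ∈ St κ, A i 0) - 1
    else (∏ i ∈ St κ, (A i 0 + A i 2)) / (∏ i ∈ St κ, A i 0) - 1 with hO
  set Φ : Fin (Mf + Mc) → ℝ := fun κ => ∑ i ∈ St κ, Real.sqrt (θ i) / (1 - Real.sqrt (θ i)) with hΦ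
  have hdata : ∀ κ, _ := fun κ => classData_hypotheses (St κ) (fun i => A i 0) (fun i => A i 1) (fun i => A i 2) θ
      (fun i _ => hApos i) (fun i _ => hAnn i 1) (fun i _ => hAnn i 2) hθ0 hθ1 (fun i _ => hθlt i)
      (fun i _ => hstar1 i) (fun i _ => hstar2 i) (fun i _ => hgm i)
  have hΘ0 : ∀ κ, 0 ≤ Θ κ := fun κ => sub_nonneg.2 (huu1 κ)
  have hΘ1 : ∀ κ, Θ κ < 1 := fun κ => by
    have : 0 < uu κ := prod_pos fun i _ => by linarith [hθlt i]
    simp only [hΘ]; linarith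
  have hO0' : ∀ κ d, 0 ≤ O κ d := by
    intro κ d
    by_cases h : d = P κ
    · simp only [hO, if_pos h]; exact (hdata κ).1
    · simp only [hO, if_neg h]; exact (hdata κ).2.1
  have hO1' : ∀ κ d, (P κ = d ∨ P' κ = d) → Θ κ ≤ (1 - Θ κ) * O κ d := by
    intro κ d hd
    by_cases h : d = P κ
    · simp only [hO, if_pos h]; exact (hdata κ).2.2.1
    · simp only [hO, if_neg h]; exact (hdata κ).2.2.2.1
  have hO2' : ∀ κ, Φ κ ^ 2 ≤ O κ (P κ) * O κ (P' κ) := by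
    intro κ
    simp only [hO, if_pos rfl, if_neg (Ne.symm (hPP' κ))]
    exact (hdata κ).2.2.2.2.1
  have hΦ4' : ∀ κ, 4 * Θ κ ≤ Φ κ := fun κ => (hdata κ).2.2.2.2.2.1
  have hΦsq' : ∀ κ, Θ κ ≤ Φ κ ^ 2 := fun κ => (hdata κ).2.2.2.2.2.2
  -- injectivity of port pairs from `hnopar`
  have hinj : Function.Injective fun X => (s(P X, P' X) : Sym2 (Fin n)) := by
    intro I K h
    by_contra hne
    apply hnopar I K hne
    rcases Sym2.eq_iff.1 h with ⟨h1, h2⟩ | ⟨h1, h2⟩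
    · exact ⟨Or.inl h1.symm, Or.inr h2.symm⟩
    · exact ⟨Or.inr h2.symm, Or.inl h1.symm⟩
  -- the forest order on `F`
  have hcastF : ∀ κ ∈ F, ∃ I : Fin Mf, Fin.castAdd Mc I = κ := by
    intro κ hκ
    have hlt : (κ : ℕ) < Mf := (mem_filter.1 hκ).2
    exact ⟨⟨κ, hlt⟩, Fin.ext rfl⟩
  have hforestF : ∀ K ∈ F, ∀ I ∈ F, K < I → P' K ≠ P I ∧ P' K ≠ P' I := by
    intro K hK I hI hKI
    obtain ⟨K', rfl⟩ := hcastF K hK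
    obtain ⟨I', rfl⟩ := hcastF I hI
    exact hforest K' I' (by rw [Fin.lt_def] at hKI ⊢; simpa using hKI)
  -- dominators from `hdomF`
  set dom : Fin (Mf + Mc) → Fin n → Fin (Mf + Mc) := fun κ d =>
    if h : ∃ I : Fin Mf, (P (Fin.castAdd Mc I) = d ∨ P' (Fin.castAdd Mc I) = d) ∧
        (P (Fin.castAdd Mc I) ∉ ({P κ, P' κ} : Finset (Fin n)) ∨ P' (Fin.castAdd Mc I) ∉ ({P κ, P' κ} : Finset (Fin n))) ∧
        uu (Fin.castAdd Mc I) ≤ uu κ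
    then Fin.castAdd Mc (Classical.choose h) else κ with hdomdef
  have hnatF : ∀ κ, κ ∉ F → ∃ K : Fin Mc, Fin.natAdd Mf K = κ := by
    intro κ hκ
    have hge : Mf ≤ (κ : ℕ) := by
      by_contra h; exact hκ (mem_filter.2 ⟨mem_univ _, by omega⟩)
    refine ⟨⟨κ - Mf, by omega⟩, Fin.ext ?_⟩
    simp only [Fin.natAdd_mk]
    omega
  have hcastmemF : ∀ I : Fin Mf, Fin.castAdd Mc I ∈ F := fun I => mem_filter.2 ⟨mem_univ _, by simp⟩
  have hdom' : ∀ X ∉ F, ∀ d, (P X = d ∨ P' X = d) →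
      dom X d ∈ F ∧ (P (dom X d) = d ∨ P' (dom X d) = d) ∧
        (∀ u, (P (dom X d) = u ∨ P' (dom X d) = u) → (P X = u ∨ P' X = u) → u = d) ∧ Θ X ≤ Θ (dom X d) := by
    intro X hX d hd
    obtain ⟨K, rfl⟩ := hnatF X hX
    have hex : ∃ I : Fin Mf, (P (Fin.castAdd Mc I) = d ∨ P' (Fin.castAdd Mc I) = d) ∧
        (P (Fin.castAdd Mc I) ∉ ({P (Fin.natAdd Mf K), P' (Fin.natAdd Mf K)} : Finset (Fin n)) ∨
          P' (Fin.castAdd Mc I) ∉ ({P (Fin.natAdd Mf K), P' (Fin.natAdd Mf K)} : Finset (Fin n))) ∧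
        uu (Fin.castAdd Mc I) ≤ uu (Fin.natAdd Mf K) :=
      hdomF K d (hd.imp Eq.symm Eq.symm)
    have hdomeq : dom (Fin.natAdd Mf K) d = Fin.castAdd Mc (Classical.choose hex) := by
      simp only [hdomdef, dif_pos hex]
    obtain ⟨hport, hoff, hle⟩ := Classical.choose_spec hex
    rw [hdomeq]
    refine ⟨hcastmemF _, hport, fun u hu huX => ?_, by simp only [hΘ]; linarith⟩
    have hdX : d ∈ ({P (Fin.natAdd Mf K), P' (Fin.natAdd Mf K)} : Finset (Fin n)) := by
      rcases hd with h | h <;> simp [h.symm]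
    have huX' : u ∈ ({P (Fin.natAdd Mf K), P' (Fin.natAdd Mf K)} : Finset (Fin n)) := by
      rcases huX with h | h <;> simp [h.symm]
    rcases hu with hu | hu
    · -- `u = P dom ∈ ports X`, so the off-port is `P' dom`, hence `P dom = d`
      rcases hport with h | h
      · exact hu.symm.trans h
      · rcases hoff with ho | ho
        · exact absurd (by rw [hu]; exact huX') ho
        · exact absurd (by rw [h]; exact hdX) ho
    · rcases hport with h | h
      · rcases hoff with ho | ho
        · exact absurd (by rw [h]; exact hdX) ho
        · exact absurd (by rw [hu]; exact huX') ho
      · exact hu.symm.trans h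
  -- (3) the class-level inequality
  have INEQ := hclass P P' hPP' hinj r F hforestF Θ hΘ0 hΘ1 O hO0' Φ hO1' hO2' hΦ4' hΦsq' dom hdom'
  -- (4) the configuration expansion identity
  set Cr : Finset (Fin (Mf + Mc)) := (univ \ F).filter (fun κ => P κ ≠ r ∧ P' κ ≠ r) with hCr
  set Ch : Finset (Fin (Mf + Mc)) := F.filter (fun a => P a = r) with hCh
  have hexp := config_expansion_identity Θ (fun κ' κ => P κ' = P κ ∨ P κ' = P' κ ∨ P' κ' = P κ ∨ P' κ' = P' κ) Cr F Ch
    (fun κ _ => Or.inl rfl)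
  have huuΘ : ∀ κ, 1 - Θ κ = uu κ := fun κ => by simp only [hΘ]; ring
  simp only [huuΘ] at hexp INEQ
  -- (4a) the chord sum
  have hsumCr : ∑ κ ∈ Cr, Θ κ * ∏ j ∈ univ.filter (fun j => ¬ (P j = P κ ∨ P j = P' κ ∨ P' j = P κ ∨ P' j = P' κ)), uu j =
      ∑ K ∈ univ.filter (fun K => P (Fin.natAdd Mf K) ≠ r ∧ P' (Fin.natAdd Mf K) ≠ r), D K := by
    rw [hCr, sum_filter, sum_filter]
    have hsplit : ∀ f : Fin (Mf + Mc) → ℝ, ∑ κ ∈ univ \ F, f κ = ∑ K : Fin Mc, f (Fin.natAdd Mf K) := by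
      intro f
      have : univ \ F = univ.filter (fun κ : Fin (Mf + Mc) => Mf ≤ (κ : ℕ)) := by
        ext κ; simp [hF]
      rw [this, sum_filter, Fin.sum_univ_add]
      have h1 : ∑ I : Fin Mf, (if Mf ≤ ((Fin.castAdd Mc I : Fin (Mf + Mc)) : ℕ) then f (Fin.castAdd Mc I) else 0) = 0 :=
        sum_eq_zero fun I _ => by rw [if_neg (by simp)]
      have h2 : ∑ K : Fin Mc, (if Mf ≤ ((Fin.natAdd Mf K : Fin (Mf + Mc)) : ℕ) then f (Fin.natAdd Mf K) else 0) =
          ∑ K : Fin Mc, f (Fin.natAdd Mf K) := sum_congr rfl fun K _ => by rw [if_pos (by simp)]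
      rw [h1, h2, zero_add]
    rw [hsplit]
  -- (4b) the forest product
  have hprodF : ∀ f : Fin (Mf + Mc) → ℝ, ∏ κ ∈ F, f κ = ∏ I : Fin Mf, f (Fin.castAdd Mc I) := by
    intro f
    rw [hF, prod_filter, Fin.prod_univ_add]
    have h1 : ∏ I : Fin Mf, (if ((Fin.castAdd Mc I : Fin (Mf + Mc)) : ℕ) < Mf then f (Fin.castAdd Mc I) else 1) =
        ∏ I : Fin Mf, f (Fin.castAdd Mc I) := prod_congr rfl fun I _ => by rw [if_pos (by simp)]
    have h2 : ∏ K : Fin Mc, (if ((Fin.natAdd Mf K : Fin (Mf + Mc)) : ℕ) < Mf then f (Fin.natAdd Mf K) else 1) = 1 :=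
      prod_eq_one fun K _ => by rw [if_neg (by simp)]
    rw [h1, h2, mul_one]
  have hsumF : ∀ f : Fin (Mf + Mc) → ℝ, ∑ κ ∈ F, f κ = ∑ I : Fin Mf, f (Fin.castAdd Mc I) := by
    intro f
    rw [hF, sum_filter, Fin.sum_univ_add]
    have h1 : ∑ I : Fin Mf, (if ((Fin.castAdd Mc I : Fin (Mf + Mc)) : ℕ) < Mf then f (Fin.castAdd Mc I) else 0) =
        ∑ I : Fin Mf, f (Fin.castAdd Mc I) := sum_congr rfl fun I _ => by rw [if_pos (by simp)]
    have h2 : ∑ K : Fin Mc, (if ((Fin.natAdd Mf K : Fin (Mf + Mc)) : ℕ) < Mf then f (Fin.natAdd Mf K) else 0) = 0 :=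
      sum_eq_zero fun K _ => by rw [if_neg (by simp)]
    rw [h1, h2, add_zero]
  -- (4c) the child-edge sum
  have hprodlt : ∀ I : Fin Mf, ∏ b ∈ F.filter (· < Fin.castAdd Mc I), uu b = ∏ K ∈ univ.filter (· < I), uu (Fin.castAdd Mc K) := by
    intro I
    rw [prod_filter, hprodF, prod_filter]
    refine prod_congr rfl fun K _ => ?_
    have : (Fin.castAdd Mc K < Fin.castAdd Mc I) ↔ K < I := by
      rw [Fin.lt_def, Fin.lt_def]; simp
    simp only [this]
  have hsumCh : ∑ a ∈ Ch, Θ a * ∏ b ∈ F.filter (· < a), uu b = ∑ I ∈ univ.filter (fun I => P (Fin.castAdd Mc I) = r), cfF I := by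
    rw [hCh, sum_filter, hsumF, sum_filter]
    refine sum_congr rfl fun I _ => ?_
    by_cases h : P (Fin.castAdd Mc I) = r
    · rw [if_pos h, if_pos h, hprodlt]
    · rw [if_neg h, if_neg h]
  -- (4d) telescoping
  have htel : ∑ I, cfF I = 1 - ∏ I, uu (Fin.castAdd Mc I) := by
    have h := nestedCoeff_sum (fun I : Fin Mf => 1 - uu (Fin.castAdd Mc I))
    simp only [sub_sub_cancel] at h
    exact h
  have hsplitCf : ∑ I ∈ univ.filter (fun I => P (Fin.castAdd Mc I) ≠ r), cfF I =
      ∑ I, cfF I - ∑ I ∈ univ.filter (fun I => P (Fin.castAdd Mc I) = r), cfF I := by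
    rw [← sum_filter_add_sum_filter_not univ (fun I => P (Fin.castAdd Mc I) = r)]
    ring
  -- the left side equals `1 + Σ_S W(S)(n(S) − y(S))`
  have hLHS : ∑ I ∈ univ.filter (fun I => P (Fin.castAdd Mc I) ≠ r), cfF I +
      ∑ K ∈ univ.filter (fun K => P (Fin.natAdd Mf K) ≠ r ∧ P' (Fin.natAdd Mf K) ≠ r), D K =
      1 + (∑ κ ∈ Cr, Θ κ * ∏ j ∈ univ.filter (fun j => ¬ (P j = P κ ∨ P j = P' κ ∨ P' j = P κ ∨ P' j = P' κ)), uu j -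
        (∏ I ∈ F, uu I + ∑ a ∈ Ch, Θ a * ∏ b ∈ F.filter (· < a), uu b)) := by
    rw [hsumCr, hsumCh, hprodF, hsplitCf, htel]; ring
  -- (5) the right side: class-word masses are within the budget
  have hmass : ∀ (T : Finset (Fin (Mf + Mc))) (δ : Fin (Mf + Mc) → Bool),
      C0 * ∏ X ∈ T, O X (if δ X then P X else P' X) =
        ∑ e ∈ (univ : Finset (Fin m → Fin 3)).filter (fun e =>
          (∀ i, cls i ∉ T → e i = 0) ∧ (∀ i, cls i ∈ T → (e i = 0 ∨ e i = (if δ (cls i) then 1 else 2))) ∧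
            (∀ X ∈ T, ∃ i, cls i = X ∧ e i ≠ 0)), ∏ x, A x (e x) := by
    intro T δ
    have hk : ∀ i, (if δ (cls i) then (1 : Fin 3) else 2) ≠ 0 := fun i => by
      cases δ (cls i) <;> simp
    have hme := classWord_mass_eq cls (fun i => if δ (cls i) then 1 else 2) hk T A hA0ne
    have hprodO : C0 * ∏ X ∈ T, O X (if δ X then P X else P' X) =
        (∏ i, A i 0) * ∏ X ∈ T, ((∏ i ∈ univ.filter (fun i => cls i = X), (A i 0 + A i (if δ (cls i) then 1 else 2))) /
          (∏ i ∈ univ.filter (fun i => cls i = X), A i 0) - 1) := by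
      congr 1
      refine prod_congr rfl fun X _ => ?_
      have hcls : ∀ i ∈ St X, cls i = X := fun i hi => (mem_filter.1 hi).2
      cases hδ : δ X
      · -- port `P' X`, coefficient index 2
        simp only [Bool.false_eq_true, ↓reduceIte, hO, if_neg (Ne.symm (hPP' X))]
        congr 2
        refine prod_congr rfl fun i hi => ?_
        rw [hcls i hi, hδ]; simp
      · simp only [↓reduceIte, hO, if_pos rfl]
        congr 2
        refine prod_congr rfl fun i hi => ?_
        rw [hcls i hi, hδ]; simp
    rw [hprodO, ← hme]
    exact sum_congr (by ext e; simp only [mem_filter, mem_univ, true_and]) (fun _ _ => rfl)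
  have hbudget := classWords_budget_le cls P P' p p' hP hP' r A hAnn
  have hRHS : C0 * ∑ T ∈ (univ : Finset (Fin (Mf + Mc))).powerset,
      ∑ δ ∈ (univ : Finset (Fin (Mf + Mc) → Bool)).filter (fun δ => (∀ X ∉ T, δ X = false) ∧
          3 ≤ (T.image fun X => if δ X then P X else P' X).card ∧ r ∉ T.image fun X => if δ X then P X else P' X),
        ∏ X ∈ T, O X (if δ X then P X else P' X) ≤
      ∑ e ∈ (univ : Finset (Fin m → Fin 3)).filter (fun e => r ∉ Rw e), (if 3 ≤ (Rw e).card then coef e else 0) := by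
    rw [mul_sum]
    simp_rw [mul_sum, hmass]
    rw [Finset.powerset_univ]
    refine le_trans (le_of_eq ?_) hbudget
    rw [sum_filter, sum_product]
    refine sum_congr rfl fun T _ => ?_
    rw [sum_filter]
    refine sum_congr rfl fun δ _ => ?_
    dsimp only
    by_cases hc : (∀ X ∉ T, δ X = false) ∧ 3 ≤ (T.image fun X => if δ X then P X else P' X).card ∧
        r ∉ T.image fun X => if δ X then P X else P' X
    · rw [if_pos hc, if_pos hc]
      exact sum_congr (by ext e; simp only [mem_filter, mem_univ, true_and]) (fun _ _ => rfl)
    · rw [if_neg hc, if_neg hc]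
  -- (6) assemble
  have hX : ∑ I ∈ univ.filter (fun I => P (Fin.castAdd Mc I) ≠ r), cfF I +
      ∑ K ∈ univ.filter (fun K => P (Fin.natAdd Mf K) ≠ r ∧ P' (Fin.natAdd Mf K) ≠ r), D K ≤
      1 + ∑ T ∈ (univ : Finset (Fin (Mf + Mc))).powerset,
        ∑ δ ∈ (univ : Finset (Fin (Mf + Mc) → Bool)).filter (fun δ => (∀ X ∉ T, δ X = false) ∧
            3 ≤ (T.image fun X => if δ X then P X else P' X).card ∧ r ∉ T.image fun X => if δ X then P X else P' X),
          ∏ X ∈ T, O X (if δ X then P X else P' X) := by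
    have INEQ' : ∑ κ ∈ Cr, Θ κ * ∏ j ∈ univ.filter (fun j => ¬ (P j = P κ ∨ P j = P' κ ∨ P' j = P κ ∨ P' j = P' κ)), uu j -
        (∏ I ∈ F, uu I + ∑ a ∈ Ch, Θ a * ∏ b ∈ F.filter (· < a), uu b) ≤
        ∑ T ∈ (univ : Finset (Fin (Mf + Mc))).powerset,
          ∑ δ ∈ (univ : Finset (Fin (Mf + Mc) → Bool)).filter (fun δ => (∀ X ∉ T, δ X = false) ∧
              3 ≤ (T.image fun X => if δ X then P X else P' X).card ∧ r ∉ T.image fun X => if δ X then P X else P' X),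
            ∏ X ∈ T, O X (if δ X then P X else P' X) := by
      refine le_of_eq_of_le ?_ INEQ
      convert hexp.symm using 9
    rw [hLHS]; linarith [INEQ']
  calc C0 * (∑ I ∈ univ.filter (fun I => P (Fin.castAdd Mc I) ≠ r), cfF I +
        ∑ K ∈ univ.filter (fun K => P (Fin.natAdd Mf K) ≠ r ∧ P' (Fin.natAdd Mf K) ≠ r), D K)
      ≤ C0 * (1 + ∑ T ∈ (univ : Finset (Fin (Mf + Mc))).powerset,
          ∑ δ ∈ (univ : Finset (Fin (Mf + Mc) → Bool)).filter (fun δ => (∀ X ∉ T, δ X = false) ∧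
              3 ≤ (T.image fun X => if δ X then P X else P' X).card ∧ r ∉ T.image fun X => if δ X then P X else P' X),
            ∏ X ∈ T, O X (if δ X then P X else P' X)) := mul_le_mul_of_nonneg_left hX hC0nn
    _ = C0 + C0 * ∑ T ∈ (univ : Finset (Fin (Mf + Mc))).powerset,
          ∑ δ ∈ (univ : Finset (Fin (Mf + Mc) → Bool)).filter (fun δ => (∀ X ∉ T, δ X = false) ∧
              3 ≤ (T.image fun X => if δ X then P X else P' X).card ∧ r ∉ T.image fun X => if δ X then P X else P' X),
            ∏ X ∈ T, O X (if δ X then P X else P' X) := by ring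
    _ ≤ _ := add_le_add le_rfl hRHS

end StarSet

end Summit.CriticalPhenomena.PercolationContinuityZ3.Theorems

end
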